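import Literature.Probability.LatticeModels.DobrushinShlosmanWeighted
import Literature.Probability.LatticeModels.DobrushinShlosmanStates
import HarnessLib

/-!
# The Dobrushin–Shlosman window comparison under a WEIGHTED received-sum condition: covariance decay of
# every Gibbs measure

Continues `DobrushinShlosmanWeighted.lean` (the weighted contraction `iterate_step_le_window_weighted` and the
comparison estimate `abs_sub_le_window_weighted`) with the measure theory of `DobrushinShlosmanStates.lean`
(Föllmer's tilt trick; the window dusting estimate `lip_windowAvg` of `DobrushinShlosmanWindowDusting.lean`).
For a general specification `γ` on `V → S` read through a cell map `cell : V → ι` (`ι` finite), window site sets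
`Λ c` / cell sets `win c`, a cell weight `w ≤ R` local in its cell and the one-boundary-cell Kantorovich
contraction of the window kernels with array `k c y x ≥ 0` of ARBITRARY range:

* `abs_covariance_le_window_weighted` — for every Gibbs measure `ν`, bounded measurable `f, g` reading the cells
  `Δf, Δg` with cell-Lipschitz vectors `δ_f, δ_g ≥ 0`, plain (`≤ γ₀ < 1`) and `θ`-weighted (`≤ γ₀ θ x`)
  per-window received sums on the windows AVOIDING `Δg`, and a weight `θ ≥ 0` with `θ ≥ 1` on the cells all of
  whose windows meet `Δg`: `|cov_ν(f, g)| ≤ 2 R² (Σ_{Δg} δ_g) Σ_{x ∈ Δf} θ x δ_f x`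
  (Georgii 2011 Remark 8.26 / Künsch 1982 inside Dobrushin–Shlosman's window iteration; Föllmer 1988 Ch. I
  Thm. (2.13) for the tilt).
* `abs_covariance_le_window_exp_profile` — the same with the REAL profile `θ = e^{-t ρ}`: `ρ ≤ 0` on the cells all
  of whose windows meet `Δg`, `ρ x ≤ ρ y + d(c; y, x)` whenever `k c y x ≠ 0`, and Föllmer's weighted constant
  `Σ_y k c y x e^{t d(c; y, x)} ≤ γ₀ < 1` on the windows avoiding `Δg`; if `ρ ≥ m` on `Δf` then
  `|cov_ν(f, g)| ≤ 2 R² e^{-t m} (Σ δ_f)(Σ δ_g)` — exponential decay with NO finite-range hypothesis on `k`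
  (contrast `DobrushinShlosmanStates.abs_covariance_le`, whose `ℕ`-profile needs a finite influence radius).

Theorems only (no definition, no named fact).

## References

* H.-O. Georgii, *Gibbs Measures and Phase Transitions*, 2nd ed. (2011), Remark 8.26, §8.2.
* H. Künsch, Comm. Math. Phys. 84 (1982) 207–222.
* H. Föllmer, LNM 1362 (1988), Ch. I Thm. (2.13), Cor. (2.14).
* R. L. Dobrushin, S. B. Shlosman (1985), Thm. 1.
-/

noncomputable section

open MeasureTheory ProbabilityTheory Finset Function

namespace Literature.Probability.LatticeModels.DobrushinShlosman

variable {ι V S : Type*} [MeasurableSpace S]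

/-- **Covariance decay under the WEIGHTED Dobrushin–Shlosman window condition** (the tilt trick of Föllmer
1988 Ch. I Thm. (2.13) on top of `abs_sub_le_window_weighted`): for a specification `γ` read on cells with
window site sets `Λ c` / cell sets `win c`, a cell weight `w ≤ R` local in its cell, the one-boundary-cell
Kantorovich contraction `hcontract` of the window kernels with coefficients `k ≥ 0` (any range), a Gibbs measure
`ν`, bounded measurable `f, g` reading the cells `Δf, Δg` with cell-Lipschitz bounds `δ_f, δ_g ≥ 0`, plain
per-window received sums `Σ_y k c y x ≤ γ₀ < 1` and weighted ones `Σ_y k c y x θ y ≤ γ₀ θ x` on every window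
avoiding `Δg`, for a weight `θ ≥ 0` with `θ x ≥ 1` whenever every window around `x` meets `Δg`:
`|cov_ν(f, g)| ≤ 2 R² (Σ_{Δg} δ_g) Σ_{x ∈ Δf} θ x δ_f x`. [cite: Georgii2011, Remark 8.26]
[cite: Follmer1988, Ch. I Theorem (2.13)] -/
theorem abs_covariance_le_window_weighted [Fintype ι] [DecidableEq ι] [DecidableEq V] {cell : V → ι}
    {w : ι → (V → S) → (V → S) → ℝ} {γ : Specification V S} {Λ : ι → Finset V} {win : ι → Finset ι}
    {k : ι → ι → ι → ℝ} {R : ℝ} (hR : 0 ≤ R) (hwR : ∀ c σ τ, w c σ τ ≤ R)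
    (hwloc : ∀ (c : ι) (σ σ' τ τ' : V → S), (∀ v, cell v = c → σ v = σ' v) →
      (∀ v, cell v = c → τ v = τ' v) → w c σ τ = w c σ' τ')
    (hγ : IsSpecification γ) (hΛ : ∀ c v, v ∈ Λ c ↔ cell v ∈ win c) (hk : ∀ c y x, 0 ≤ k c y x)
    (hcontract : ∀ (c y : ι), y ∉ win c → ∀ (ω η : V → S), (∀ v, cell v ≠ y → ω v = η v) →
      ∀ (f : (V → S) → ℝ) (δ : ι → ℝ), Measurable f → (∃ B, ∀ σ, |f σ| ≤ B) →
        DependsOn f {v | cell v ∈ win c} → (∀ x, 0 ≤ δ x) →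
        (∀ (x : ι) (σ τ : V → S), (∀ v, cell v ≠ x → σ v = τ v) → |f σ - f τ| ≤ δ x * w x σ τ) →
          |∫ σ, f σ ∂(γ (Λ c) ω) - ∫ σ, f σ ∂(γ (Λ c) η)| ≤ (∑ x ∈ win c, k c y x * δ x) * w y ω η)
    {ν : Measure (V → S)} (hν : IsGibbsMeasure γ ν) {f g : (V → S) → ℝ} (hfm : Measurable f)
    (hgm : Measurable g) {Bf Bg : ℝ} (hBf : ∀ σ, |f σ| ≤ Bf) (hBg : ∀ σ, |g σ| ≤ Bg)
    {Δf Δg : Finset ι} (hfdep : DependsOn f {v | cell v ∈ Δf}) (hgdep : DependsOn g {v | cell v ∈ Δg})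
    {δf δg : ι → ℝ} (hδf0 : ∀ x, 0 ≤ δf x)
    (hδf : ∀ (x : ι) (σ τ : V → S), (∀ v, cell v ≠ x → σ v = τ v) → |f σ - f τ| ≤ δf x * w x σ τ)
    (hδg0 : ∀ x, 0 ≤ δg x)
    (hδg : ∀ (x : ι) (σ τ : V → S), (∀ v, cell v ≠ x → σ v = τ v) → |g σ - g τ| ≤ δg x * w x σ τ)
    {γ₀ : ℝ} (hγ₀ : 0 ≤ γ₀) (hγ₁ : γ₀ < 1)
    (hsumU : ∀ c, (∀ z ∈ win c, z ∉ Δg) → ∀ x ∈ win c, ∑ y, k c y x ≤ γ₀)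
    {θ : ι → ℝ} (hθ0 : ∀ x, 0 ≤ θ x) (hθ1 : ∀ x, (∀ c, x ∈ win c → ∃ z ∈ win c, z ∈ Δg) → 1 ≤ θ x)
    (hsumθ : ∀ c, (∀ z ∈ win c, z ∉ Δg) → ∀ x ∈ win c, ∑ y, k c y x * θ y ≤ γ₀ * θ x) :
    |cov[f, g; ν]| ≤ 2 * R ^ 2 * (∑ y ∈ Δg, δg y) * ∑ x ∈ Δf, θ x * δf x := by
  -- adapted from `DobrushinShlosman.abs_covariance_le` (profile form), weights instead of a profile
  haveI := hν.isProbabilityMeasure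
  obtain ⟨τ₀, -⟩ := nonempty_of_measure_ne_zero (μ := ν) (s := Set.univ) (by simp)
  -- cutting a cell-Lipschitz bound down to the cells an observable reads
  have restrict : ∀ {F : (V → S) → ℝ} {δ : ι → ℝ} {Δ : Finset ι}, DependsOn F {v | cell v ∈ Δ} →
      (∀ (x : ι) (σ τ : V → S), (∀ v, cell v ≠ x → σ v = τ v) → |F σ - F τ| ≤ δ x * w x σ τ) →
      ∀ (x : ι) (σ τ : V → S), (∀ v, cell v ≠ x → σ v = τ v) →
        |F σ - F τ| ≤ (if x ∈ Δ then δ x else 0) * w x σ τ := by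
    intro F δ Δ hdep hδ x σ τ hστ
    split_ifs with hx
    · exact hδ x σ τ hστ
    · rw [hdep fun v (hv : cell v ∈ Δ) => hστ v fun hvx => hx (hvx ▸ hv), sub_self, abs_zero, zero_mul]
  have restrict0 : ∀ {δ : ι → ℝ} {Δ : Finset ι}, (∀ x, 0 ≤ δ x) → ∀ x, 0 ≤ (if x ∈ Δ then δ x else 0) :=
    fun hδ0 x => by split_ifs; exacts [hδ0 x, le_rfl]
  -- the shifted density `g̃ ∈ [0, 2 S_g]`
  set Sg : ℝ := R * ∑ y ∈ Δg, δg y with hSg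
  have hSg0 : 0 ≤ Sg := mul_nonneg hR (Finset.sum_nonneg fun y _ => hδg0 y)
  have hosc : ∀ σ, |g σ - g τ₀| ≤ Sg := fun σ => by
    have h := abs_sub_le_sum_cells hwR (restrict0 hδg0) (restrict hgdep hδg) σ τ₀
    rwa [Finset.sum_ite_mem, Finset.univ_inter] at h
  set gt : (V → S) → ℝ := fun σ => g σ + (Sg - g τ₀) with hgt
  have hgt0 : ∀ σ, 0 ≤ gt σ := fun σ => by
    have := (abs_le.1 (hosc σ)).1; simp only [hgt]; linarith
  have hgtB : ∀ σ, gt σ ≤ 2 * Sg := fun σ => by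
    have := (abs_le.1 (hosc σ)).2; simp only [hgt]; linarith
  have hgtm : Measurable gt := hgm.add_const _
  have hgtdep : DependsOn gt {v | cell v ∈ Δg} := fun σ τ h => by
    simp only [hgt]; rw [hgdep h]
  have hgi : Integrable g ν := DobrushinMetric.integrable_of_abs_le' hgm hBg
  have hgtabs : ∀ σ, |gt σ| ≤ 2 * Sg := fun σ => by
    rw [abs_of_nonneg (hgt0 σ)]; exact hgtB σ
  have hgti : Integrable gt ν := DobrushinMetric.integrable_of_abs_le' hgtm hgtabs
  -- the right-hand side is nonnegative
  have hRHS : 0 ≤ 2 * R ^ 2 * (∑ y ∈ Δg, δg y) * ∑ x ∈ Δf, θ x * δf x := by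
    have := Finset.sum_nonneg fun y (_ : y ∈ Δg) => hδg0 y
    have := Finset.sum_nonneg fun x (_ : x ∈ Δf) => mul_nonneg (hθ0 x) (hδf0 x)
    positivity
  -- `cov(f, g) = cov(f, g̃) = ν(f g̃) - ν(f) ν(g̃)`
  have hcov : cov[f, g; ν] = ∫ σ, f σ * gt σ ∂ν - (∫ σ, f σ ∂ν) * ∫ σ, gt σ ∂ν := by
    have h1 : cov[f, g; ν] = cov[f, gt; ν] := by
      rw [hgt, covariance_add_const_right hgi]
    rw [h1, covariance_eq_sub]
    · rfl
    · exact memLp_of_bounded (a := -Bf) (b := Bf)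
        (ae_of_all _ fun σ => abs_le.1 (hBf σ)) hfm.aestronglyMeasurable 2
    · exact memLp_of_bounded (a := -(2 * Sg)) (b := 2 * Sg)
        (ae_of_all _ fun σ => abs_le.1 (hgtabs σ)) hgtm.aestronglyMeasurable 2
  by_cases hz : ∫ σ, gt σ ∂ν = 0
  · -- degenerate case: `g̃ = 0` a.e., so the covariance vanishes
    have hae : gt =ᵐ[ν] 0 := (integral_eq_zero_iff_of_nonneg (fun σ => hgt0 σ) hgti).1 hz
    have hfg : ∫ σ, f σ * gt σ ∂ν = 0 := by
      rw [← integral_zero (α := V → S) (μ := ν) (G := ℝ)]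
      refine integral_congr_ae ?_
      filter_upwards [hae] with σ hσ
      simp [hσ]
    rw [hcov, hfg, hz, mul_zero, sub_zero, abs_zero]
    exact hRHS
  have hpos : 0 < ∫ σ, gt σ ∂ν := lt_of_le_of_ne (integral_nonneg hgt0) (Ne.symm hz)
  -- the window dusting data: bounded measurable observables, cell-Lipschitz bounds, `T c = γ_{Λ c}`
  set Adm : ((V → S) → ℝ) → Prop := fun F => Measurable F ∧ ∃ B, ∀ σ, |F σ| ≤ B with hAdm
  set Lip : ((V → S) → ℝ) → (ι → ℝ) → Prop := fun F δ => (∀ x, 0 ≤ δ x) ∧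
    ∀ (x : ι) (σ τ : V → S), (∀ v, cell v ≠ x → σ v = τ v) → |F σ - F τ| ≤ δ x * w x σ τ with hLip
  set T : ι → ((V → S) → ℝ) → ((V → S) → ℝ) := fun c F η => ∫ σ, F σ ∂(γ (Λ c) η) with hT
  have hlip0 : ∀ ⦃F : (V → S) → ℝ⦄ ⦃δ : ι → ℝ⦄, Lip F δ → ∀ x, 0 ≤ δ x := fun F δ h => h.1
  have hoscA : ∀ ⦃F : (V → S) → ℝ⦄ ⦃δ : ι → ℝ⦄, Adm F → Lip F δ → ∀ σ τ, |F σ - F τ| ≤ R * ∑ x, δ x :=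
    fun F δ _ h => abs_sub_le_sum_cells hwR h.1 h.2
  have hTA : ∀ ⦃F : (V → S) → ℝ⦄ (c : ι), Adm F → Adm (T c F) := fun F c h =>
    ⟨measurable_windowAvg' hγ (Λ c) h.1, h.2.imp fun B hB η => abs_windowAvg_le' hγ (Λ c) hB η⟩
  have hdust : ∀ ⦃F : (V → S) → ℝ⦄ ⦃δ : ι → ℝ⦄ (c : ι), Adm F → Lip F δ →
      Lip (T c F) fun y => if y ∈ win c then 0 else δ y + ∑ x ∈ win c, k c y x * δ x := by
    intro F δ c hF hδ
    obtain ⟨hFm, B, hB⟩ := hF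
    refine ⟨fun y => ?_, fun y ω η hωη =>
      lip_windowAvg hγ hwloc (hΛ c) (hcontract c) hFm hB hδ.1 hδ.2 y ω η hωη⟩
    dsimp only
    split_ifs
    · exact le_rfl
    · exact add_nonneg (hδ.1 y) (Finset.sum_nonneg fun x _ => mul_nonneg (hk c y x) (hδ.1 x))
  -- the two invariant states: `ν` and its tilt by `g̃`, usable centres = windows avoiding `Δg`
  set U : Finset ι := Finset.univ.filter fun c => ∀ z ∈ win c, z ∉ Δg with hUdef
  set E₁ : ((V → S) → ℝ) → ℝ := fun F => ∫ σ, F σ ∂ν with hE₁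
  set E₂ : ((V → S) → ℝ) → ℝ := fun F => (∫ σ, gt σ * F σ ∂ν) / ∫ σ, gt σ ∂ν with hE₂
  have h₁le : ∀ ⦃F : (V → S) → ℝ⦄ ⦃M : ℝ⦄, Adm F → (∀ σ, F σ ≤ M) → E₁ F ≤ M := by
    rintro F M ⟨hFm, B, hB⟩ hM
    calc ∫ σ, F σ ∂ν ≤ ∫ _σ, M ∂ν :=
          integral_mono (DobrushinMetric.integrable_of_abs_le' hFm hB) (integrable_const M) hM
      _ = M := by simp
  have h₁ge : ∀ ⦃F : (V → S) → ℝ⦄ ⦃M : ℝ⦄, Adm F → (∀ σ, M ≤ F σ) → M ≤ E₁ F := by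
    rintro F M ⟨hFm, B, hB⟩ hM
    calc M = ∫ _σ, M ∂ν := by simp
      _ ≤ ∫ σ, F σ ∂ν := integral_mono (integrable_const M) (DobrushinMetric.integrable_of_abs_le' hFm hB) hM
  have h₁T : ∀ ⦃F : (V → S) → ℝ⦄ (c : ι), c ∈ U → Adm F → E₁ (T c F) = E₁ F := by
    rintro F c - ⟨hFm, B, hB⟩
    exact hν.integral_integral_eq hγ (Λ c) (DobrushinMetric.integrable_of_abs_le' hFm hB)
  have hgfi : ∀ {F : (V → S) → ℝ}, Measurable F → ∀ {B : ℝ}, (∀ σ, |F σ| ≤ B) →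
      Integrable (fun σ => gt σ * F σ) ν := fun hFm B hB =>
    hgti.mul_bdd hFm.aestronglyMeasurable (ae_of_all _ fun σ => by rw [Real.norm_eq_abs]; exact hB σ)
  have h₂le : ∀ ⦃F : (V → S) → ℝ⦄ ⦃M : ℝ⦄, Adm F → (∀ σ, F σ ≤ M) → E₂ F ≤ M := by
    rintro F M ⟨hFm, B, hB⟩ hM
    change (∫ σ, gt σ * F σ ∂ν) / ∫ σ, gt σ ∂ν ≤ M
    rw [div_le_iff₀ hpos]
    calc ∫ σ, gt σ * F σ ∂ν ≤ ∫ σ, gt σ * M ∂ν :=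
          integral_mono (hgfi hFm hB) (hgti.mul_const M) fun σ => mul_le_mul_of_nonneg_left (hM σ) (hgt0 σ)
      _ = M * ∫ σ, gt σ ∂ν := by rw [integral_mul_const, mul_comm]
  have h₂ge : ∀ ⦃F : (V → S) → ℝ⦄ ⦃M : ℝ⦄, Adm F → (∀ σ, M ≤ F σ) → M ≤ E₂ F := by
    rintro F M ⟨hFm, B, hB⟩ hM
    change M ≤ (∫ σ, gt σ * F σ ∂ν) / ∫ σ, gt σ ∂ν
    rw [le_div_iff₀ hpos]
    calc M * ∫ σ, gt σ ∂ν = ∫ σ, gt σ * M ∂ν := by rw [integral_mul_const, mul_comm]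
      _ ≤ ∫ σ, gt σ * F σ ∂ν :=
          integral_mono (hgti.mul_const M) (hgfi hFm hB) fun σ => mul_le_mul_of_nonneg_left (hM σ) (hgt0 σ)
  have h₂T : ∀ ⦃F : (V → S) → ℝ⦄ (c : ι), c ∈ U → Adm F → E₂ (T c F) = E₂ F := by
    rintro F c hc ⟨hFm, B, hB⟩
    change (∫ η, gt η * (∫ σ, F σ ∂(γ (Λ c) η)) ∂ν) / ∫ σ, gt σ ∂ν = (∫ σ, gt σ * F σ ∂ν) / ∫ σ, gt σ ∂ν
    congr 1
    simp_rw [mul_windowAvg_eq_of_dependsOn hγ (hΛ c) hgtdep (Finset.mem_filter.1 hc).2]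
    exact hν.integral_integral_eq hγ (Λ c) (hgfi hFm hB)
  -- the received sums and the weight, read on `U`
  have hsumU' : ∀ c ∈ U, ∀ x ∈ win c, ∑ y, k c y x ≤ γ₀ := fun c hc =>
    hsumU c (Finset.mem_filter.1 hc).2
  have hsumθ' : ∀ c ∈ U, ∀ x ∈ win c, ∑ y, k c y x * θ y ≤ γ₀ * θ x := fun c hc =>
    hsumθ c (Finset.mem_filter.1 hc).2
  have hθ1' : ∀ x, (∀ c ∈ U, x ∉ win c) → 1 ≤ θ x := by
    intro x hx
    refine hθ1 x fun c hxc => ?_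
    by_contra hcon
    simp only [not_exists, not_and] at hcon
    exact hx c (Finset.mem_filter.2 ⟨Finset.mem_univ _, fun z hz hzg => hcon z hz hzg⟩) hxc
  -- the comparison theorem for `f` with its Lipschitz vector cut down to `Δf`
  have key := abs_sub_le_window_weighted hR hlip0 hoscA hk hTA hdust h₁le h₁ge h₁T h₂le h₂ge h₂T hγ₀ hγ₁
    hsumU' hθ0 hθ1' hsumθ' (F := f) (δ := fun x => if x ∈ Δf then δf x else 0) ⟨hfm, Bf, hBf⟩
    ⟨restrict0 hδf0, restrict hfdep hδf⟩
  have hsumΔ : ∑ x, θ x * (if x ∈ Δf then δf x else 0) = ∑ x ∈ Δf, θ x * δf x := by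
    rw [← Finset.sum_filter_add_sum_filter_not Finset.univ (fun x => x ∈ Δf)]
    have h1 : ∑ x ∈ Finset.univ.filter (fun x => x ∈ Δf), θ x * (if x ∈ Δf then δf x else 0) =
        ∑ x ∈ Δf, θ x * δf x := by
      rw [Finset.filter_mem_eq_inter, Finset.univ_inter]
      exact Finset.sum_congr rfl fun x hx => by rw [if_pos hx]
    have h2 : ∑ x ∈ Finset.univ.filter (fun x => ¬x ∈ Δf), θ x * (if x ∈ Δf then δf x else 0) = 0 :=
      Finset.sum_eq_zero fun x hx => by rw [if_neg (Finset.mem_filter.1 hx).2, mul_zero]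
    rw [h1, h2, add_zero]
  rw [hsumΔ] at key
  change |∫ σ, f σ ∂ν - (∫ σ, gt σ * f σ ∂ν) / ∫ σ, gt σ ∂ν| ≤ R * ∑ x ∈ Δf, θ x * δf x at key
  -- `cov = ν(g̃) · (ν_{g̃}(f) - ν(f))`
  have hfgt : ∫ σ, f σ * gt σ ∂ν = ∫ σ, gt σ * f σ ∂ν :=
    integral_congr_ae (ae_of_all _ fun σ => mul_comm _ _)
  have hident : cov[f, g; ν] =
      (∫ σ, gt σ ∂ν) * ((∫ σ, gt σ * f σ ∂ν) / ∫ σ, gt σ ∂ν - ∫ σ, f σ ∂ν) := by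
    rw [hcov, hfgt, mul_sub, mul_div_cancel₀ _ hz]
    ring
  rw [hident, abs_mul, abs_of_pos hpos, abs_sub_comm]
  have hgtint : ∫ σ, gt σ ∂ν ≤ 2 * Sg := by
    calc ∫ σ, gt σ ∂ν ≤ ∫ _σ, 2 * Sg ∂ν := integral_mono hgti (integrable_const _) hgtB
      _ = 2 * Sg := by simp
  have hkey0 : 0 ≤ R * ∑ x ∈ Δf, θ x * δf x :=
    mul_nonneg hR (Finset.sum_nonneg fun x _ => mul_nonneg (hθ0 x) (hδf0 x))
  calc (∫ σ, gt σ ∂ν) * |∫ σ, f σ ∂ν - (∫ σ, gt σ * f σ ∂ν) / ∫ σ, gt σ ∂ν|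
      ≤ (2 * Sg) * (R * ∑ x ∈ Δf, θ x * δf x) :=
        mul_le_mul hgtint key (abs_nonneg _) (by positivity)
    _ = 2 * R ^ 2 * (∑ y ∈ Δg, δg y) * ∑ x ∈ Δf, θ x * δf x := by
        rw [hSg]; ring

/-- **Covariance decay with Föllmer's exponentially weighted constant** (Föllmer 1988 Ch. I Cor. (2.14) /
Georgii 2011 Remark 8.26 / Künsch 1982, for overlapping windows): in the setting of
`abs_covariance_le_window_weighted`, let `t ≥ 0`, a real profile `ρ` on the cells with `ρ ≤ 0` on every cell all
of whose windows meet `Δg` and `ρ x ≤ ρ y + d(c; y, x)` whenever `x ∈ win c` receives influence from `y`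
(`k c y x ≠ 0`) through a window avoiding `Δg`, for a nonnegative "reach" `d`, and let the WEIGHTED received
sums satisfy `Σ_y k c y x e^{t d(c; y, x)} ≤ γ₀ < 1` on the windows avoiding `Δg`. If `ρ ≥ m` on `Δf` then
`|cov_ν(f, g)| ≤ 2 R² e^{-t m} (Σ_{Δf} δ_f)(Σ_{Δg} δ_g)` — no finite-range hypothesis on `k`.
[cite: Follmer1988, Ch. I Corollary (2.14)] [cite: Georgii2011, Remark 8.26] -/
theorem abs_covariance_le_window_exp_profile [Fintype ι] [DecidableEq ι] [DecidableEq V] {cell : V → ι}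
    {w : ι → (V → S) → (V → S) → ℝ} {γ : Specification V S} {Λ : ι → Finset V} {win : ι → Finset ι}
    {k : ι → ι → ι → ℝ} {R : ℝ} (hR : 0 ≤ R) (hwR : ∀ c σ τ, w c σ τ ≤ R)
    (hwloc : ∀ (c : ι) (σ σ' τ τ' : V → S), (∀ v, cell v = c → σ v = σ' v) →
      (∀ v, cell v = c → τ v = τ' v) → w c σ τ = w c σ' τ')
    (hγ : IsSpecification γ) (hΛ : ∀ c v, v ∈ Λ c ↔ cell v ∈ win c) (hk : ∀ c y x, 0 ≤ k c y x)
    (hcontract : ∀ (c y : ι), y ∉ win c → ∀ (ω η : V → S), (∀ v, cell v ≠ y → ω v = η v) →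
      ∀ (f : (V → S) → ℝ) (δ : ι → ℝ), Measurable f → (∃ B, ∀ σ, |f σ| ≤ B) →
        DependsOn f {v | cell v ∈ win c} → (∀ x, 0 ≤ δ x) →
        (∀ (x : ι) (σ τ : V → S), (∀ v, cell v ≠ x → σ v = τ v) → |f σ - f τ| ≤ δ x * w x σ τ) →
          |∫ σ, f σ ∂(γ (Λ c) ω) - ∫ σ, f σ ∂(γ (Λ c) η)| ≤ (∑ x ∈ win c, k c y x * δ x) * w y ω η)
    {ν : Measure (V → S)} (hν : IsGibbsMeasure γ ν) {f g : (V → S) → ℝ} (hfm : Measurable f)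
    (hgm : Measurable g) {Bf Bg : ℝ} (hBf : ∀ σ, |f σ| ≤ Bf) (hBg : ∀ σ, |g σ| ≤ Bg)
    {Δf Δg : Finset ι} (hfdep : DependsOn f {v | cell v ∈ Δf}) (hgdep : DependsOn g {v | cell v ∈ Δg})
    {δf δg : ι → ℝ} (hδf0 : ∀ x, 0 ≤ δf x)
    (hδf : ∀ (x : ι) (σ τ : V → S), (∀ v, cell v ≠ x → σ v = τ v) → |f σ - f τ| ≤ δf x * w x σ τ)
    (hδg0 : ∀ x, 0 ≤ δg x)
    (hδg : ∀ (x : ι) (σ τ : V → S), (∀ v, cell v ≠ x → σ v = τ v) → |g σ - g τ| ≤ δg x * w x σ τ)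
    {γ₀ t : ℝ} (hγ₀ : 0 ≤ γ₀) (hγ₁ : γ₀ < 1) (ht : 0 ≤ t) {ρ : ι → ℝ} {dd : ι → ι → ι → ℝ}
    (hdd : ∀ c y x, 0 ≤ dd c y x) (hρ0 : ∀ x, (∀ c, x ∈ win c → ∃ z ∈ win c, z ∈ Δg) → ρ x ≤ 0)
    (hρ : ∀ c, (∀ z ∈ win c, z ∉ Δg) → ∀ x ∈ win c, ∀ y, k c y x ≠ 0 → ρ x ≤ ρ y + dd c y x)
    (hsumw : ∀ c, (∀ z ∈ win c, z ∉ Δg) → ∀ x ∈ win c, ∑ y, k c y x * Real.exp (t * dd c y x) ≤ γ₀)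
    {m : ℝ} (hm : ∀ x ∈ Δf, m ≤ ρ x) :
    |cov[f, g; ν]| ≤ 2 * R ^ 2 * Real.exp (-(t * m)) * (∑ x ∈ Δf, δf x) * ∑ y ∈ Δg, δg y := by
  -- the weight `θ = e^{-t ρ}`
  have hθ0 : ∀ x, 0 ≤ Real.exp (-(t * ρ x)) := fun x => (Real.exp_pos _).le
  have hθ1 : ∀ x, (∀ c, x ∈ win c → ∃ z ∈ win c, z ∈ Δg) → 1 ≤ Real.exp (-(t * ρ x)) := fun x hx =>
    Real.one_le_exp (by nlinarith [hρ0 x hx])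
  have hsumU : ∀ c, (∀ z ∈ win c, z ∉ Δg) → ∀ x ∈ win c, ∑ y, k c y x ≤ γ₀ := by
    intro c hc x hx
    refine le_trans (Finset.sum_le_sum fun y _ => ?_) (hsumw c hc x hx)
    exact le_mul_of_one_le_right (hk c y x) (Real.one_le_exp (mul_nonneg ht (hdd c y x)))
  have hsumθ : ∀ c, (∀ z ∈ win c, z ∉ Δg) → ∀ x ∈ win c,
      ∑ y, k c y x * Real.exp (-(t * ρ y)) ≤ γ₀ * Real.exp (-(t * ρ x)) := by
    intro c hc x hx
    have hterm : ∀ y, k c y x * Real.exp (-(t * ρ y)) ≤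
        (k c y x * Real.exp (t * dd c y x)) * Real.exp (-(t * ρ x)) := by
      intro y
      by_cases hk0 : k c y x = 0
      · rw [hk0]; simp
      · rw [mul_assoc, ← Real.exp_add]
        refine mul_le_mul_of_nonneg_left (Real.exp_le_exp.2 ?_) (hk c y x)
        nlinarith [hρ c hc x hx y hk0]
    calc ∑ y, k c y x * Real.exp (-(t * ρ y))
        ≤ ∑ y, (k c y x * Real.exp (t * dd c y x)) * Real.exp (-(t * ρ x)) := Finset.sum_le_sum fun y _ => hterm y
      _ = (∑ y, k c y x * Real.exp (t * dd c y x)) * Real.exp (-(t * ρ x)) := by rw [Finset.sum_mul]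
      _ ≤ γ₀ * Real.exp (-(t * ρ x)) := mul_le_mul_of_nonneg_right (hsumw c hc x hx) (hθ0 x)
  have key := abs_covariance_le_window_weighted hR hwR hwloc hγ hΛ hk hcontract hν hfm hgm hBf hBg hfdep hgdep
    hδf0 hδf hδg0 hδg hγ₀ hγ₁ hsumU hθ0 hθ1 hsumθ
  refine key.trans ?_
  -- `θ ≤ e^{-t m}` on `Δf`
  have hΔf : ∑ x ∈ Δf, Real.exp (-(t * ρ x)) * δf x ≤ Real.exp (-(t * m)) * ∑ x ∈ Δf, δf x := by
    rw [Finset.mul_sum]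
    refine Finset.sum_le_sum fun x hx => mul_le_mul_of_nonneg_right (Real.exp_le_exp.2 ?_) (hδf0 x)
    nlinarith [hm x hx]
  have hg0 : 0 ≤ ∑ y ∈ Δg, δg y := Finset.sum_nonneg fun y _ => hδg0 y
  calc 2 * R ^ 2 * (∑ y ∈ Δg, δg y) * ∑ x ∈ Δf, Real.exp (-(t * ρ x)) * δf x
      ≤ 2 * R ^ 2 * (∑ y ∈ Δg, δg y) * (Real.exp (-(t * m)) * ∑ x ∈ Δf, δf x) :=
        mul_le_mul_of_nonneg_left hΔf (by positivity)
    _ = 2 * R ^ 2 * Real.exp (-(t * m)) * (∑ x ∈ Δf, δf x) * ∑ y ∈ Δg, δg y := by ring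

end Literature.Probability.LatticeModels.DobrushinShlosman

end
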